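import Mathlib
import Literature.Analysis.FluidPDE.VectorCalculus
import Literature.Analysis.FluidPDE.TaoAveragedNondegeneracy

/-!
# Rigidity of exactly gyration-free arcs of the self-similar binormal profile ODE — I: algebra
(helper for the registered stub `stub_mirrorPointSelection` of crux `FilamentSkeletonRss.SkeletonEquilibrium`,
stmt-NavierStokesRegularity-15400, lines `mirror-point-negation` / `zero-accretion-selection`)

The stub concerns unit-speed `C²` solutions `Yo` of the profile ("forced binormal", Lorentz-type) equation
`Yo″ = g · Yo′ × A Yo`, `g = 4π/γ_k ≠ 0`, `A y = ½ y − α e₃ × y` (`α ≠ 0`, `e₃ = EuclideanSpace.single 2 1`),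
and its hypothesis is the smallness in a shell of the FIRST-ORDER GYRATION-FREE defect
`Yo′ − c b − (c / g / ‖B‖²) b × B_t` (`B = A Yo`, `b = B/‖B‖`, `B_t = A Yo′`, `c = ⟪Yo′, b⟫`).
With `T = Yo′`, `n = ‖B‖²`, `c' = ⟪T, B⟫`, `q = n T − c' B` this defect is `F / (g n²)` where
`F(B, T) = g n q − c' · B × A T`, and along the flow `B′ = A T`, `T′ = g T × B`.

Results of this file (sorry-free, hypothesis-free algebra):
* `certificate` — the polynomial identity
  `2 c'² n ⟪F_dot, q⟫ = g c' Q (3Q + 2 c'² n) − (8 g Q + 2 g c'² n)·(c' n ⟪A T, q⟫) − c' n ‖T‖²·(c' ⟪B × A T, q⟫ − g n Q)`,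
  `Q = ‖q‖²`, where `F_dot(B, T)` is the derivative of `F` along the flow (written out; that it IS the flow
  derivative is `…GyrationFreeArcs.hasDerivAt_F`) and the two bracketed residuals vanish on `{F = 0}`
  (`residual_inner`, `residual_cross`); hence `flowDeriv_inner_on_locus`: on the locus
  `2 c'² n ⟪F_dot, q⟫ = g c' Q (3Q + 2c'²n)` — a gyration PRODUCTION rate of definite sign;
* `rigidity_algebra` — `F = 0` and `⟪F_dot, q⟫ = 0` (with `g ≠ 0`, `α ≠ 0`, `T ≠ 0`) force `B` onto the
  rotation axis (`B 0 = B 1 = 0`): the first-order slow (guiding-centre) manifold of this Lorentz system is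
  NOWHERE flow-invariant off the axis, for every `g ≠ 0`, `α ≠ 0` (no special parameter pair).
The ODE corollary (exactly gyration-free arcs lie on the axis) is in `…GyrationFreeArcs`. Consequence for the
stub (recorded there): for FIXED `(γ_k, α)` the registered `stub_mirrorPointSelection` follows from this
rigidity by continuous dependence on initial data and compactness of the waist data — a pure-analysis
statement, not a certified-numerics one. (Identity found and cross-checked with computer algebra, proved by
coordinate expansion.) No summit statement is proved; NS regularity is not touched.
-/

noncomputable section

open Set Filter Topology
open Literature.Analysis.FluidPDE Literature.Analysis.FluidPDE.Tao2016
open scoped RealInnerProductSpace InnerProductSpace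

namespace Summit.NavierStokesRegularity.NavierStokesRegularity.Theorems.SkeletonEquilibrium.MirrorPoint
set_option linter.dupNamespace false

/-! ## Coordinates -/

/-- Coordinates of the rotating Leray drift `A y = ½ y − α e₃ × y`: `(½y₀ + αy₁, ½y₁ − αy₀, ½y₂)`. [folklore] -/
theorem drift_apply (α : ℝ) (y : EuclideanSpace ℝ (Fin 3)) :
    ((1 / 2 : ℝ) • y - α • cross (EuclideanSpace.single (2 : Fin 3) (1 : ℝ)) y) 0 = 1 / 2 * y 0 + α * y 1 ∧
    ((1 / 2 : ℝ) • y - α • cross (EuclideanSpace.single (2 : Fin 3) (1 : ℝ)) y) 1 = 1 / 2 * y 1 - α * y 0 ∧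
    ((1 / 2 : ℝ) • y - α • cross (EuclideanSpace.single (2 : Fin 3) (1 : ℝ)) y) 2 = 1 / 2 * y 2 := by
  refine ⟨?_, ?_, ?_⟩ <;>
  simp [cross_apply_zero, cross_apply_one, cross_apply_two]

/-! ## The certificate identity -/

/-- **Certificate.** With `n = ⟪B,B⟫`, `c = ⟪T,B⟫`, `q = n T − c B`, `Q = ⟪q,q⟫`, `A T = ½T − α e₃×T` and the
flow derivative `F_dot` of `F = (g n) q − c · B × A T` along `B′ = A T`, `T′ = g T × B` (written out), the
polynomial identity
`2 c² n ⟪F_dot, q⟫ = g c Q (3Q + 2c²n) − (8gQ + 2gc²n)(c n ⟪A T, q⟫) − c n ⟪T,T⟫ (c ⟪B × A T, q⟫ − g n Q)`.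
(Found and cross-checked with computer algebra; proved by coordinate expansion.) [folklore] -/
theorem certificate (g α : ℝ) (B T : EuclideanSpace ℝ (Fin 3)) :
    2 * ⟪T, B⟫ ^ 2 * ⟪B, B⟫ *
      ⟪(2 * g * ⟪B, (1 / 2 : ℝ) • T - α • cross (EuclideanSpace.single (2 : Fin 3) (1 : ℝ)) T⟫) •
            (⟪B, B⟫ • T - ⟪T, B⟫ • B) +
          (g * ⟪B, B⟫) •
            ((2 * ⟪B, (1 / 2 : ℝ) • T - α • cross (EuclideanSpace.single (2 : Fin 3) (1 : ℝ)) T⟫) • T +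
              (g * ⟪B, B⟫) • cross T B - (1 / 2 * ⟪T, T⟫) • B -
              ⟪T, B⟫ • ((1 / 2 : ℝ) • T - α • cross (EuclideanSpace.single (2 : Fin 3) (1 : ℝ)) T)) -
          (1 / 2 * ⟪T, T⟫) • cross B ((1 / 2 : ℝ) • T - α • cross (EuclideanSpace.single (2 : Fin 3) (1 : ℝ)) T) -
          (⟪T, B⟫ * g) •
            cross B ((1 / 2 : ℝ) • cross T B - α • cross (EuclideanSpace.single (2 : Fin 3) (1 : ℝ)) (cross T B)),
        ⟪B, B⟫ • T - ⟪T, B⟫ • B⟫ =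
      g * ⟪T, B⟫ * ⟪⟪B, B⟫ • T - ⟪T, B⟫ • B, ⟪B, B⟫ • T - ⟪T, B⟫ • B⟫ *
          (3 * ⟪⟪B, B⟫ • T - ⟪T, B⟫ • B, ⟪B, B⟫ • T - ⟪T, B⟫ • B⟫ + 2 * ⟪T, B⟫ ^ 2 * ⟪B, B⟫) -
        (8 * g * ⟪⟪B, B⟫ • T - ⟪T, B⟫ • B, ⟪B, B⟫ • T - ⟪T, B⟫ • B⟫ + 2 * g * ⟪T, B⟫ ^ 2 * ⟪B, B⟫) *
          (⟪T, B⟫ * ⟪B, B⟫ *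
            ⟪(1 / 2 : ℝ) • T - α • cross (EuclideanSpace.single (2 : Fin 3) (1 : ℝ)) T, ⟪B, B⟫ • T - ⟪T, B⟫ • B⟫) -
        ⟪T, B⟫ * ⟪B, B⟫ * ⟪T, T⟫ *
          (⟪T, B⟫ * ⟪cross B ((1 / 2 : ℝ) • T - α • cross (EuclideanSpace.single (2 : Fin 3) (1 : ℝ)) T),
              ⟪B, B⟫ • T - ⟪T, B⟫ • B⟫ -
            g * ⟪B, B⟫ * ⟪⟪B, B⟫ • T - ⟪T, B⟫ • B, ⟪B, B⟫ • T - ⟪T, B⟫ • B⟫) := by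
  simp only [real_inner_fin3, cross_apply_zero, cross_apply_one, cross_apply_two, PiLp.add_apply,
    PiLp.sub_apply, PiLp.smul_apply, smul_eq_mul, PiLp.single_apply]
  simp
  ring


/-! ## The two residuals vanish on the gyration-free locus `F = 0` -/

/-- `⟪B, nT − cB⟫ = 0` identically (`n = ⟪B,B⟫`, `c = ⟪T,B⟫`). [folklore] -/
theorem inner_perp_part (B T : EuclideanSpace ℝ (Fin 3)) : ⟪B, ⟪B, B⟫ • T - ⟪T, B⟫ • B⟫ = 0 := by
  rw [inner_sub_right, real_inner_smul_right, real_inner_smul_right, real_inner_comm T B]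
  ring

/-- First residual: on `F = 0`, i.e. `(g n) • q = c • B × A T`, pairing with `q` gives
`c ⟪B × A T, q⟫ = g n ⟪q, q⟫`. [folklore] -/
theorem residual_inner {g α : ℝ} {B T : EuclideanSpace ℝ (Fin 3)}
    (hM : (g * ⟪B, B⟫) • (⟪B, B⟫ • T - ⟪T, B⟫ • B) =
      ⟪T, B⟫ • cross B ((1 / 2 : ℝ) • T - α • cross (EuclideanSpace.single (2 : Fin 3) (1 : ℝ)) T)) :
    ⟪T, B⟫ * ⟪cross B ((1 / 2 : ℝ) • T - α • cross (EuclideanSpace.single (2 : Fin 3) (1 : ℝ)) T),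
        ⟪B, B⟫ • T - ⟪T, B⟫ • B⟫ -
      g * ⟪B, B⟫ * ⟪⟪B, B⟫ • T - ⟪T, B⟫ • B, ⟪B, B⟫ • T - ⟪T, B⟫ • B⟫ = 0 := by
  have h := congrArg (fun v => ⟪v, ⟪B, B⟫ • T - ⟪T, B⟫ • B⟫) hM
  simp only [real_inner_smul_left] at h
  linarith

/-- Second residual: on `F = 0`, pairing with `B × q` and using Binet–Cauchy
`⟪B × A T, B × q⟫ = ⟪B,B⟫⟪A T, q⟫ − ⟪B, q⟫⟪A T, B⟫` with `⟪B, q⟫ = 0`, `⟪q, B × q⟫ = 0` gives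
`c n ⟪A T, q⟫ = 0`. [folklore] -/
theorem residual_cross {g α : ℝ} {B T : EuclideanSpace ℝ (Fin 3)}
    (hM : (g * ⟪B, B⟫) • (⟪B, B⟫ • T - ⟪T, B⟫ • B) =
      ⟪T, B⟫ • cross B ((1 / 2 : ℝ) • T - α • cross (EuclideanSpace.single (2 : Fin 3) (1 : ℝ)) T)) :
    ⟪T, B⟫ * ⟪B, B⟫ *
      ⟪(1 / 2 : ℝ) • T - α • cross (EuclideanSpace.single (2 : Fin 3) (1 : ℝ)) T, ⟪B, B⟫ • T - ⟪T, B⟫ • B⟫ = 0 := by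
  have h := congrArg (fun v => ⟪v, cross B (⟪B, B⟫ • T - ⟪T, B⟫ • B)⟫) hM
  simp only [real_inner_smul_left, inner_self_cross_right, mul_zero, inner_cross_cross,
    inner_perp_part, zero_mul, sub_zero] at h
  linarith

/-- **Gyration production rate on the locus.** On `F = 0` the certificate collapses to
`2 c² n ⟪F_dot, q⟫ = g c Q (3Q + 2c²n)` (`Q = ‖q‖²`): the flow derivative of the defect has a component
along `q` of the sign of `g c` and size `≍ Q`, vanishing only where `q = 0`. [folklore] -/
theorem flowDeriv_inner_on_locus {g α : ℝ} {B T : EuclideanSpace ℝ (Fin 3)}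
    (hM : (g * ⟪B, B⟫) • (⟪B, B⟫ • T - ⟪T, B⟫ • B) =
      ⟪T, B⟫ • cross B ((1 / 2 : ℝ) • T - α • cross (EuclideanSpace.single (2 : Fin 3) (1 : ℝ)) T)) :
    2 * ⟪T, B⟫ ^ 2 * ⟪B, B⟫ *
      ⟪(2 * g * ⟪B, (1 / 2 : ℝ) • T - α • cross (EuclideanSpace.single (2 : Fin 3) (1 : ℝ)) T⟫) •
            (⟪B, B⟫ • T - ⟪T, B⟫ • B) +
          (g * ⟪B, B⟫) •
            ((2 * ⟪B, (1 / 2 : ℝ) • T - α • cross (EuclideanSpace.single (2 : Fin 3) (1 : ℝ)) T⟫) • T +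
              (g * ⟪B, B⟫) • cross T B - (1 / 2 * ⟪T, T⟫) • B -
              ⟪T, B⟫ • ((1 / 2 : ℝ) • T - α • cross (EuclideanSpace.single (2 : Fin 3) (1 : ℝ)) T)) -
          (1 / 2 * ⟪T, T⟫) • cross B ((1 / 2 : ℝ) • T - α • cross (EuclideanSpace.single (2 : Fin 3) (1 : ℝ)) T) -
          (⟪T, B⟫ * g) •
            cross B ((1 / 2 : ℝ) • cross T B - α • cross (EuclideanSpace.single (2 : Fin 3) (1 : ℝ)) (cross T B)),
        ⟪B, B⟫ • T - ⟪T, B⟫ • B⟫ =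
      g * ⟪T, B⟫ * ⟪⟪B, B⟫ • T - ⟪T, B⟫ • B, ⟪B, B⟫ • T - ⟪T, B⟫ • B⟫ *
        (3 * ⟪⟪B, B⟫ • T - ⟪T, B⟫ • B, ⟪B, B⟫ • T - ⟪T, B⟫ • B⟫ + 2 * ⟪T, B⟫ ^ 2 * ⟪B, B⟫) := by
  have hres1 := residual_inner hM
  have hres2 := residual_cross hM
  have hcert := certificate g α B T
  rw [hres1, hres2, mul_zero, mul_zero, sub_zero, sub_zero] at hcert
  exact hcert

/-! ## Rigidity (algebraic form) -/

/-- **Rigidity, algebraic form.** If `g ≠ 0`, `α ≠ 0`, `T ≠ 0`, the point `(B, T)` lies on the first-order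
gyration-free locus `(g n) • (n T − c B) = c • B × A T` AND the flow derivative of `F` there is orthogonal to
`q = n T − c B`, then `B` is on the rotation axis: `B 0 = 0 ∧ B 1 = 0`. (By `certificate` and the two
residuals, `g c Q (3Q + 2c²n) = 0`; `c ≠ 0` because `c = 0` would force `T = 0`; so `Q = 0`, `n T = c B`,
whence `B × A B = 0`, whose vertical component is `−α (B₀² + B₁²)`.) [folklore] -/
theorem rigidity_algebra {g α : ℝ} {B T : EuclideanSpace ℝ (Fin 3)} (hg : g ≠ 0) (hα : α ≠ 0) (hT : T ≠ 0)
    (hM : (g * ⟪B, B⟫) • (⟪B, B⟫ • T - ⟪T, B⟫ • B) =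
      ⟪T, B⟫ • cross B ((1 / 2 : ℝ) • T - α • cross (EuclideanSpace.single (2 : Fin 3) (1 : ℝ)) T))
    (hZ : ⟪(2 * g * ⟪B, (1 / 2 : ℝ) • T - α • cross (EuclideanSpace.single (2 : Fin 3) (1 : ℝ)) T⟫) •
            (⟪B, B⟫ • T - ⟪T, B⟫ • B) +
          (g * ⟪B, B⟫) •
            ((2 * ⟪B, (1 / 2 : ℝ) • T - α • cross (EuclideanSpace.single (2 : Fin 3) (1 : ℝ)) T⟫) • T +
              (g * ⟪B, B⟫) • cross T B - (1 / 2 * ⟪T, T⟫) • B -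
              ⟪T, B⟫ • ((1 / 2 : ℝ) • T - α • cross (EuclideanSpace.single (2 : Fin 3) (1 : ℝ)) T)) -
          (1 / 2 * ⟪T, T⟫) • cross B ((1 / 2 : ℝ) • T - α • cross (EuclideanSpace.single (2 : Fin 3) (1 : ℝ)) T) -
          (⟪T, B⟫ * g) •
            cross B ((1 / 2 : ℝ) • cross T B - α • cross (EuclideanSpace.single (2 : Fin 3) (1 : ℝ)) (cross T B)),
        ⟪B, B⟫ • T - ⟪T, B⟫ • B⟫ = 0) :
    B 0 = 0 ∧ B 1 = 0 := by
  by_cases hB : B = 0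
  · subst hB; simp
  have hres1 := residual_inner hM
  have hres2 := residual_cross hM
  have hcert := certificate g α B T
  -- abbreviations
  set n : ℝ := ⟪B, B⟫ with hn_def
  set c : ℝ := ⟪T, B⟫ with hc_def
  set q : EuclideanSpace ℝ (Fin 3) := n • T - c • B with hq_def
  set Q : ℝ := ⟪q, q⟫ with hQ_def
  have hn : 0 < n := real_inner_self_pos.2 hB
  -- `c ≠ 0`: otherwise `F = 0` reads `(g n n) • T = 0`
  have hc : c ≠ 0 := by
    intro hc0
    have h1 : (g * n * n) • T = 0 := by
      have := hM
      rw [hq_def, hc0, zero_smul, sub_zero, zero_smul, smul_smul] at this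
      exact this
    rcases smul_eq_zero.1 h1 with h | h
    · exact mul_ne_zero (mul_ne_zero hg hn.ne') hn.ne' h
    · exact hT h
  -- the certificate collapses to `g c Q (3Q + 2c²n) = 0`
  have hkey : g * c * Q * (3 * Q + 2 * c ^ 2 * n) = 0 := by
    linear_combination (-1 : ℝ) * hcert + (2 * c ^ 2 * n) * hZ +
      (8 * g * Q + 2 * g * c ^ 2 * n) * hres2 + (c * n * ⟪T, T⟫) * hres1
  have hQ0 : Q = 0 := by
    have hQnn : 0 ≤ Q := real_inner_self_nonneg
    have hpos : 0 < 3 * Q + 2 * c ^ 2 * n := by positivity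
    have h1 : Q * (3 * Q + 2 * c ^ 2 * n) = 0 := by
      have := hkey
      have hgc : g * c ≠ 0 := mul_ne_zero hg hc
      have : g * c * (Q * (3 * Q + 2 * c ^ 2 * n)) = 0 := by linarith [this]
      exact (mul_eq_zero.1 this).resolve_left hgc
    exact (mul_eq_zero.1 h1).resolve_right hpos.ne'
  have hq0 : q = 0 := inner_self_eq_zero.1 hQ0
  -- `n T = c B`, hence `B × A T = 0` and `B × A B = 0`
  have hTB : n • T = c • B := sub_eq_zero.1 hq0
  have hcross : cross B ((1 / 2 : ℝ) • T - α • cross (EuclideanSpace.single (2 : Fin 3) (1 : ℝ)) T) = 0 := by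
    have h1 : c • cross B ((1 / 2 : ℝ) • T - α • cross (EuclideanSpace.single (2 : Fin 3) (1 : ℝ)) T) = 0 := by
      rw [← hM, hq0, smul_zero]
    exact (smul_eq_zero.1 h1).resolve_left hc
  have hT' : T = (c / n) • B := by
    have : T = n⁻¹ • (n • T) := by rw [smul_smul, inv_mul_cancel₀ hn.ne', one_smul]
    rw [this, hTB, smul_smul, div_eq_inv_mul]
  -- vertical component of `B × A B`
  have h2 := congrArg (fun v => v 2) hcross
  simp only [hT', cross_apply_two, PiLp.zero_apply] at h2
  rw [(drift_apply α ((c / n) • B)).1, (drift_apply α ((c / n) • B)).2.1] at h2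
  simp only [PiLp.smul_apply, smul_eq_mul] at h2
  have h3 : α * (c / n) * (B 0 ^ 2 + B 1 ^ 2) = 0 := by linarith [h2]
  have hcn : α * (c / n) ≠ 0 := mul_ne_zero hα (div_ne_zero hc hn.ne')
  have h4 : B 0 ^ 2 + B 1 ^ 2 = 0 := (mul_eq_zero.1 h3).resolve_left hcn
  constructor <;> nlinarith [sq_nonneg (B 0), sq_nonneg (B 1)]

end Summit.NavierStokesRegularity.NavierStokesRegularity.Theorems.SkeletonEquilibrium.MirrorPoint
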